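import Summits.Ventures.Crystal3D.Theorems.StickyWulffConstantCoaxialWallLawSeamIncoherentAssemblySum
import HarnessLib

/-!
# The MULTI-CORE split of the joint (A)-summand: several cores at once, each pair charged to a core that sees it whole, the rest as a residual sum
# (crux `CoaxialWallLaw`, stmt-Ventures-19481; line `WallLedgerF`, skeleton 'CoaxialWallLawCertificates' v8.1, stub `stub_incoherentSeamSmall`, F-TAIL-g12 §7)

HONEST FRAMING. Venture `Summits/Ventures/Crystal3D` (cell `crystal3d-full`); a census-free comparison inequality for the crux `CoaxialWallLaw` (stmt-Ventures-19481,
`route-Ventures-StickyWulffConstant`), lane F T5b — the first typed piece of the MULTI-PIECE proposal of F-TAIL-g12 §7 (readers are exact, so every (A)-pair near the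
payer is a core pair of the piece of ITS READER's placement; each piece is certificate matter with pools eroded by at most the junk cap table).  Nothing about the
stubs is claimed; whether v8.2 adopts the multi-piece split is cf-p1's decision; F-C1 not moved.
* `loweredPool Y E b` — the lowered pool of the core `E ⊆ Y` at `b` (`p_E(b) − heal(b) + def(b)`, the expression of `…SeamCoreSplit`), `coreTerm Y E v S₁ S₂ z` — the
  core term `Σ_{b ∈ E, |b−z| ≤ 1, loaded in E} e_E(b)/loweredPool`; `sum_coreMult_div_le_coreTerm` — the core half of the split for ONE core (verbatim the argument of
  `…SeamIncoherentAssemblySum.localSummandA_le_core_add_seamSum`);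
* `restMultA Y 𝓔 v S₁ S₂ b` — pairs at `b` that are core pairs of NO core of the family `𝓔`; `endMultA_le_sum_coreMultA_add_restMultA`;
* **`localSummandA_le_sum_coreTerms_add_rest`** — for a finite family `𝓔` of cores `E ⊆ Y` with positive lowered pools at their loaded balls within `1` of `z`:
  `Σ_A(Y, z) ≤ Σ_{E ∈ 𝓔} coreTerm Y E z + Σ_{b, |b−z| ≤ 1, restMultA b > 0} restMultA(b)/pooledDef Y b`.
  With `𝓔 = {coreOf X z S}` this is the single-core split; with `𝓔 = {pieces of the readers near z}` the residual is the cross-move remainder of §7(3).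
-/

noncomputable section

namespace Summit.Ventures.Crystal3D.Theorems

namespace TailResidue

open Summit.Ventures.Crystal3D Finset
open scoped InnerProductSpace

section MultiCore

variable {Y : Finset (EuclideanSpace ℝ (Fin 3))} {v : WordVersion} {S₁ S₂ : PlateSystem}

open scoped Classical in
/-- The LOWERED POOL of the core `E ⊆ Y` at `b`: core pool minus the healing contacts (core ball within `1` of `b`, foreign ball) plus the deficiency of the foreign
balls within `1` of `b` — the denominator of `…SeamCoreSplit.localSummandA_le_core_add_seam`. -/
def loweredPool (Y E : Finset (EuclideanSpace ℝ (Fin 3))) (b : EuclideanSpace ℝ (Fin 3)) : ℝ :=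
  pooledDef E b - ((((E.filter fun y => dist b y ≤ 1) ×ˢ (Y \ E)).filter fun p => dist p.1 p.2 = 1).card : ℝ) +
    ∑ x ∈ (Y \ E).filter (fun x => dist b x ≤ 1 ∧ (Y.filter fun q => dist x q = 1).card ≤ 11), ((12 : ℝ) - ((Y.filter fun q => dist x q = 1).card : ℝ))

open scoped Classical in
/-- The CORE TERM of `E` at the payer `z`: `Σ_{b ∈ E, |b − z| ≤ 1, e_E(b) > 0} e_E(b) / loweredPool Y E b`. -/
def coreTerm (Y E : Finset (EuclideanSpace ℝ (Fin 3))) (v : WordVersion) (S₁ S₂ : PlateSystem) (z : EuclideanSpace ℝ (Fin 3)) : ℝ :=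
  ∑ b ∈ E.filter (fun b => dist z b ≤ 1 ∧ 0 < endMultA E v S₁ S₂ b), (endMultA E v S₁ S₂ b : ℝ) / loweredPool Y E b

open scoped Classical in
/-- **The core half of the split for one core** (`hexact` of `…SeamIncoherentAssemblySum.localSummandA_le_core_add_seamSum`): the core multiplicities of `Y` through
`E`, over the pools of `Y`, are bounded by the core term of `E`. -/
theorem sum_coreMult_div_le_coreTerm {E : Finset (EuclideanSpace ℝ (Fin 3))} (hY : ∀ p ∈ Y, ∀ q ∈ Y, p ≠ q → 1 ≤ dist p q) (hsub : E ⊆ Y)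
    (h₁ : S₁.RT ⊆ fccSlots) (h₂ : S₂.RT ⊆ fccSlots) (z : EuclideanSpace ℝ (Fin 3))
    (hposE : ∀ b ∈ E, dist z b ≤ 1 → 0 < endMultA E v S₁ S₂ b → 0 < loweredPool Y E b) :
    ∑ b ∈ Y.filter (fun b => dist z b ≤ 1 ∧ 0 < endMultA Y v S₁ S₂ b), (coreMultA Y E v S₁ S₂ b : ℝ) / pooledDef Y b ≤ coreTerm Y E v S₁ S₂ z := by
  unfold coreTerm
  have hexle : ∀ b, coreMultA Y E v S₁ S₂ b ≤ endMultA E v S₁ S₂ b := fun b => coreMultA_le hY hsub h₁ h₂ b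
  have hpoolle : ∀ b, pooledDef E b +
      ∑ x ∈ (Y \ E).filter (fun x => dist b x ≤ 1 ∧ (Y.filter fun q => dist x q = 1).card ≤ 11), ((12 : ℝ) - ((Y.filter fun q => dist x q = 1).card : ℝ)) ≤
      pooledDef Y b + (((E.filter fun y => dist b y ≤ 1) ×ˢ (Y \ E)).filter fun p => dist p.1 p.2 = 1).card := fun b => pooledDef_core_le hY hsub b
  set A := Y.filter (fun b => dist z b ≤ 1 ∧ 0 < endMultA Y v S₁ S₂ b) with hA
  set AE := E.filter (fun b => dist z b ≤ 1 ∧ 0 < endMultA E v S₁ S₂ b) with hAE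
  set gE : EuclideanSpace ℝ (Fin 3) → ℝ := fun b => (endMultA E v S₁ S₂ b : ℝ) / loweredPool Y E b with hgE
  set fX : EuclideanSpace ℝ (Fin 3) → ℝ := fun b => (coreMultA Y E v S₁ S₂ b : ℝ) / pooledDef Y b with hfX
  have key : ∀ b ∈ A, (0 < coreMultA Y E v S₁ S₂ b → b ∈ AE ∧ fX b ≤ gE b) ∧ (coreMultA Y E v S₁ S₂ b = 0 → fX b = 0) := by
    intro b hb
    obtain ⟨hbY, hb1, hepos⟩ := mem_filter.1 hb
    refine ⟨fun hx => ?_, fun h0 => by simp only [hfX, h0, Nat.cast_zero, zero_div]⟩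
    obtain ⟨q, hq⟩ : ∃ q, q ∈ Y.filter fun q => IsCorePairA Y E v S₁ S₂ b q := by
      by_contra hne
      push Not at hne
      have : coreMultA Y E v S₁ S₂ b = 0 := by
        unfold coreMultA; rw [card_eq_zero]; exact eq_empty_of_forall_notMem hne
      omega
    obtain ⟨-, -, -, G, d, -, -, -, -, hbE, -⟩ := (mem_filter.1 hq).2
    have hle := hexle b
    have hp := hpoolle b
    have hDpos : 0 < loweredPool Y E b := hposE b hbE hb1 (lt_of_lt_of_le hx hle)
    have hDle : loweredPool Y E b ≤ pooledDef Y b := by unfold loweredPool; linarith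
    refine ⟨mem_filter.2 ⟨hbE, hb1, lt_of_lt_of_le hx hle⟩, ?_⟩
    have hleR : (coreMultA Y E v S₁ S₂ b : ℝ) ≤ (endMultA E v S₁ S₂ b : ℝ) := by exact_mod_cast hle
    calc fX b = (coreMultA Y E v S₁ S₂ b : ℝ) / pooledDef Y b := rfl
      _ ≤ (endMultA E v S₁ S₂ b : ℝ) / pooledDef Y b := div_le_div_of_nonneg_right hleR (hDpos.le.trans hDle)
      _ ≤ gE b := div_le_div_of_nonneg_left (Nat.cast_nonneg _) hDpos hDle
  have hgnn : ∀ b ∈ AE, 0 ≤ gE b := fun b hb => div_nonneg (Nat.cast_nonneg _) (hposE b (mem_filter.1 hb).1 (mem_filter.1 hb).2.1 (mem_filter.1 hb).2.2).le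
  calc ∑ b ∈ A, fX b = ∑ b ∈ A.filter (fun b => 0 < coreMultA Y E v S₁ S₂ b), fX b :=
        (sum_filter_of_ne fun b hb hne => Nat.pos_of_ne_zero fun h0 => hne ((key b hb).2 h0)).symm
    _ ≤ ∑ b ∈ A.filter (fun b => 0 < coreMultA Y E v S₁ S₂ b), gE b :=
        sum_le_sum fun b hb => ((key b (mem_filter.1 hb).1).1 (mem_filter.1 hb).2).2
    _ ≤ ∑ b ∈ AE, gE b :=
        sum_le_sum_of_subset_of_nonneg (fun b hb => ((key b (mem_filter.1 hb).1).1 (mem_filter.1 hb).2).1) fun b hb _ => hgnn b hb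

variable (Y v S₁ S₂)

open scoped Classical in
/-- RESIDUAL MULTIPLICITY of `b` with respect to a family of cores: the (A)-end pairs `(b, q)` of `Y` that are core pairs of NO core of the family. -/
def restMultA (𝓔 : Finset (Finset (EuclideanSpace ℝ (Fin 3)))) (b : EuclideanSpace ℝ (Fin 3)) : ℕ :=
  (Y.filter fun q => IsEndPairA Y v S₁ S₂ b q ∧ ∀ E ∈ 𝓔, ¬ IsCorePairA Y E v S₁ S₂ b q).card

variable {Y v S₁ S₂}

open scoped Classical in
/-- Every (A)-pair is a core pair of some core of the family or residual: `e_Y(b) ≤ Σ_{E ∈ 𝓔} coreMultA Y E b + restMultA Y 𝓔 b`. -/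
theorem endMultA_le_sum_coreMultA_add_restMultA (𝓔 : Finset (Finset (EuclideanSpace ℝ (Fin 3)))) (b : EuclideanSpace ℝ (Fin 3)) :
    endMultA Y v S₁ S₂ b ≤ ∑ E ∈ 𝓔, coreMultA Y E v S₁ S₂ b + restMultA Y v S₁ S₂ 𝓔 b := by
  unfold endMultA coreMultA restMultA
  have hcover : (Y.filter fun q => IsEndPairA Y v S₁ S₂ b q) ⊆
      (𝓔.biUnion fun E => Y.filter fun q => IsCorePairA Y E v S₁ S₂ b q) ∪ (Y.filter fun q => IsEndPairA Y v S₁ S₂ b q ∧ ∀ E ∈ 𝓔, ¬ IsCorePairA Y E v S₁ S₂ b q) := by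
    intro q hq
    obtain ⟨hqY, hp⟩ := mem_filter.1 hq
    by_cases h : ∃ E ∈ 𝓔, IsCorePairA Y E v S₁ S₂ b q
    · obtain ⟨E, hE, hc⟩ := h
      exact mem_union.2 (Or.inl (mem_biUnion.2 ⟨E, hE, mem_filter.2 ⟨hqY, hc⟩⟩))
    · push Not at h
      exact mem_union.2 (Or.inr (mem_filter.2 ⟨hqY, hp, h⟩))
  exact (card_le_card hcover).trans ((card_union_le _ _).trans (Nat.add_le_add_right card_biUnion_le _))

open scoped Classical in
/-- **THE MULTI-CORE SPLIT**: for a finite family of cores `E ⊆ Y` whose lowered pools are positive at their loaded balls within `1` of the payer,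
`Σ_A(Y, z) ≤ Σ_{E ∈ 𝓔} coreTerm Y E z + Σ_{b ∈ Y, |b − z| ≤ 1, restMultA b > 0} restMultA(b) / pooledDef Y b`. -/
theorem localSummandA_le_sum_coreTerms_add_rest (hY : ∀ p ∈ Y, ∀ q ∈ Y, p ≠ q → 1 ≤ dist p q) (h₁ : S₁.RT ⊆ fccSlots) (h₂ : S₂.RT ⊆ fccSlots)
    (z : EuclideanSpace ℝ (Fin 3)) (𝓔 : Finset (Finset (EuclideanSpace ℝ (Fin 3)))) (hsub : ∀ E ∈ 𝓔, E ⊆ Y)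
    (hpos : ∀ E ∈ 𝓔, ∀ b ∈ E, dist z b ≤ 1 → 0 < endMultA E v S₁ S₂ b → 0 < loweredPool Y E b) :
    localSummandA v S₁ S₂ Y z ≤ ∑ E ∈ 𝓔, coreTerm Y E v S₁ S₂ z +
      ∑ b ∈ Y.filter (fun b => dist z b ≤ 1 ∧ 0 < restMultA Y v S₁ S₂ 𝓔 b), (restMultA Y v S₁ S₂ 𝓔 b : ℝ) / pooledDef Y b := by
  unfold localSummandA
  set A := Y.filter (fun b => dist z b ≤ 1 ∧ 0 < endMultA Y v S₁ S₂ b) with hA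
  set AR := Y.filter (fun b => dist z b ≤ 1 ∧ 0 < restMultA Y v S₁ S₂ 𝓔 b) with hAR
  have hp0 : ∀ b, 0 ≤ pooledDef Y b := fun b => EndRowFloor.pooledDef_nonneg Y b
  -- numerator bound, termwise
  have hterm : ∀ b ∈ A, (endMultA Y v S₁ S₂ b : ℝ) / pooledDef Y b ≤
      ∑ E ∈ 𝓔, (coreMultA Y E v S₁ S₂ b : ℝ) / pooledDef Y b + (restMultA Y v S₁ S₂ 𝓔 b : ℝ) / pooledDef Y b := by
    intro b _
    rw [← sum_div, ← add_div]
    refine div_le_div_of_nonneg_right ?_ (hp0 b)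
    exact_mod_cast endMultA_le_sum_coreMultA_add_restMultA 𝓔 b
  refine (sum_le_sum hterm).trans ?_
  rw [sum_add_distrib, sum_comm]
  refine add_le_add (sum_le_sum fun E hE => sum_coreMult_div_le_coreTerm hY (hsub E hE) h₁ h₂ z (hpos E hE)) ?_
  -- residual part: drop the vanishing terms, then restrict
  have hrest : ∑ b ∈ A, (restMultA Y v S₁ S₂ 𝓔 b : ℝ) / pooledDef Y b = ∑ b ∈ A.filter (fun b => 0 < restMultA Y v S₁ S₂ 𝓔 b), (restMultA Y v S₁ S₂ 𝓔 b : ℝ) / pooledDef Y b :=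
    (sum_filter_of_ne fun b _ hne => Nat.pos_of_ne_zero fun h0 => hne (by simp only [h0, Nat.cast_zero, zero_div])).symm
  rw [hrest]
  refine sum_le_sum_of_subset_of_nonneg (fun b hb => ?_) fun b _ _ => div_nonneg (Nat.cast_nonneg _) (hp0 b)
  obtain ⟨hbA, hr⟩ := mem_filter.1 hb
  exact mem_filter.2 ⟨(mem_filter.1 hbA).1, (mem_filter.1 hbA).2.1, hr⟩

/-- **The single-core split is the case `𝓔 = {E}`** (sanity: the residual multiplicity is then `seamCoreMultA`). -/
theorem restMultA_singleton (E : Finset (EuclideanSpace ℝ (Fin 3))) (b : EuclideanSpace ℝ (Fin 3)) :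
    restMultA Y v S₁ S₂ {E} b = seamCoreMultA Y E v S₁ S₂ b := by
  classical
  unfold restMultA seamCoreMultA
  congr 1
  ext q
  simp only [mem_filter, mem_singleton, forall_eq]

end MultiCore

end TailResidue

end Summit.Ventures.Crystal3D.Theorems

end
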